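import Summits.AtomisticToContinuum.Crystallization.Theorems.FreeSplittingCertificatesStrictSplittingRuleCoreDefsStar
import Summits.AtomisticToContinuum.Crystallization.Theorems.FreeSplittingCertificatesStrictSplittingRuleCoreFirstOrderDesignGeometry

/-!
# `StrictSplittingRule` (stmt-AtomisticToContinuum-12560), line `registered`: the sitewise form of H2⋆ and its Bravais covariance (reshape r5, lead c5)

Route `FreeSplittingCertificates`, crux r3 `StrictSplittingRule`, line `registered`.  H2⋆ = `CoreStarCoercive a h κ₁ κ₃`
(…CoreDefsStar.lean) asserts ONE covariant transfer table and, for every finitely supported displacement field `u`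
and EVERY site `p`, a sitewise inequality.  This file names that inequality, `CoreStarSiteIneq a h κ₁ κ₃ Y M N u p`
(definitionally the body of `CoreStarCoercive`, see `coreStarCoercive_iff_site`), and proves its BRAVAIS COVARIANCE:
translating `u` by an even-layer index `g` (a translation of the crystal, `h1_sub_of_even`) moves the inequality from
`p` to `p + g` (`coreStarSiteIneq_translate`).  Consequence `coreStarCoercive_of_two_sites`: a certificate needs the
sitewise inequality only at the two sublattice representatives `(0,0,0)` and `(1,0,0)` — the reduction every finite
(torus / interval-arithmetic) certificate of H2⋆ uses (lead c5, FAR-FIELD-ANALYSIS.md).  Line-internal bookkeeping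
([folklore]); nothing here closes an item.
-/

noncomputable section

namespace Summit.AtomisticToContinuum.Crystallization.Theorems.StrictSplittingRuleBirth

open scoped BigOperators Classical
open Literature.MathematicalPhysics.StatisticalMechanics
open Literature.Geometry.DiscreteGeometry
open Summit.AtomisticToContinuum.Crystallization.Theorems.PalmUnimodularRigidity.LayeredLawsSelectHcp
  (hcpSite ljSqDeriv)

/-- **The sitewise inequality of H2⋆** at site `p` for the displacement field `u` and the tables `(Y, M, N)`:
for some skew `W`, `κ₁·Σ_shell⟨y_q−y_p,u_q−u_p⟩² + κ₃·Σ_shell‖u_q−u_p−W(y_q−y_p)‖²` is at most the naive half-split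
second variation at `p` plus the antisymmetrised quadratic transfers at `p` (verbatim the body of `CoreStarCoercive`). [folklore] -/
def CoreStarSiteIneq (a h κ₁ κ₃ : ℝ) (Y : Finset (ℤ × ℤ × ℤ))
    (M N : Bool → (ℤ × ℤ × ℤ) → (ℤ × ℤ × ℤ) → (ℤ × ℤ × ℤ) → ℝ)
    (u : ℤ × ℤ × ℤ → EuclideanSpace ℝ (Fin 3)) (p : ℤ × ℤ × ℤ) : Prop :=
  ∃ W : EuclideanSpace ℝ (Fin 3) →ₗ[ℝ] EuclideanSpace ℝ (Fin 3), (∀ z : EuclideanSpace ℝ (Fin 3), inner ℝ (W z) z = 0) ∧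
      κ₁ * (∑' q : ℤ × ℤ × ℤ,
          (if 0 < ‖hcpSite a h q - hcpSite a h p‖ ∧ ‖hcpSite a h q - hcpSite a h p‖ ≤ 11 / 10 * a then
            (inner ℝ (hcpSite a h q - hcpSite a h p) (u q - u p)) ^ 2 else (0 : ℝ))) +
      κ₃ * (∑' q : ℤ × ℤ × ℤ,
          (if 0 < ‖hcpSite a h q - hcpSite a h p‖ ∧ ‖hcpSite a h q - hcpSite a h p‖ ≤ 11 / 10 * a then
            ‖u q - u p - W (hcpSite a h q - hcpSite a h p)‖ ^ 2 else (0 : ℝ))) ≤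
      (∑' q : ℤ × ℤ × ℤ, (if q = p then (0 : ℝ) else
          1 / 2 * (ljSqDeriv (‖hcpSite a h q - hcpSite a h p‖ ^ 2) * ‖u q - u p‖ ^ 2 +
            2 * (1 / 2 * (7 * ((‖hcpSite a h q - hcpSite a h p‖ ^ 2)⁻¹) ^ 8 -
              4 * ((‖hcpSite a h q - hcpSite a h p‖ ^ 2)⁻¹) ^ 5)) *
              (inner ℝ (hcpSite a h q - hcpSite a h p) (u q - u p)) ^ 2))) +
      (∑' q : ℤ × ℤ × ℤ, (if q = p then (0 : ℝ) else
          ∑ s ∈ Y, ∑ s' ∈ Y,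
            (M (decide (Even p.1)) (q - p) s s' *
                (inner ℝ (hcpSite a h (p + s) - hcpSite a h p) (u (p + s) - u p) *
                  inner ℝ (hcpSite a h (p + s') - hcpSite a h p) (u (p + s') - u p)) -
              M (decide (Even q.1)) (p - q) s s' *
                (inner ℝ (hcpSite a h (q + s) - hcpSite a h q) (u (q + s) - u q) *
                  inner ℝ (hcpSite a h (q + s') - hcpSite a h q) (u (q + s') - u q)) +
              (N (decide (Even p.1)) (q - p) s s' - N (decide (Even q.1)) (p - q) s' s) *
                (inner ℝ (hcpSite a h (p + s) - hcpSite a h p) (u (p + s) - u p) *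
                  inner ℝ (hcpSite a h (q + s') - hcpSite a h q) (u (q + s') - u q)))))

/-- H2⋆ is, definitionally, "one covariant decaying table, and the sitewise inequality at every site". -/
theorem coreStarCoercive_iff_site {a h κ₁ κ₃ : ℝ} :
    CoreStarCoercive a h κ₁ κ₃ ↔
      ∃ (C : ℝ) (Y : Finset (ℤ × ℤ × ℤ)) (M N : Bool → (ℤ × ℤ × ℤ) → (ℤ × ℤ × ℤ) → (ℤ × ℤ × ℤ) → ℝ),
        (∀ b d s s', s ∉ Y ∨ s' ∉ Y → M b d s s' = 0 ∧ N b d s s' = 0) ∧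
        (∀ p q : ℤ × ℤ × ℤ, ∀ s s', |M (decide (Even p.1)) (q - p) s s'| ≤
            C * ((1 + ‖hcpSite a h q - hcpSite a h p‖)⁻¹) ^ 6 ∧
          |N (decide (Even p.1)) (q - p) s s'| ≤ C * ((1 + ‖hcpSite a h q - hcpSite a h p‖)⁻¹) ^ 6) ∧
        ∀ u : ℤ × ℤ × ℤ → EuclideanSpace ℝ (Fin 3), (Function.support u).Finite →
          ∀ p : ℤ × ℤ × ℤ, CoreStarSiteIneq a h κ₁ κ₃ Y M N u p :=
  Iff.rfl

/-! ## Bravais covariance -/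

/-- Translating both indices by an even-layer `g` does not change a bond vector: `y_{q+g} − y_{p+g} = y_q − y_p`.
[folklore] -/
theorem coreStarSite_sub_translate (a h : ℝ) {g : ℤ × ℤ × ℤ} (hg : Even g.1) (q p : ℤ × ℤ × ℤ) :
    hcpSite a h (q + g) - hcpSite a h (p + g) = hcpSite a h q - hcpSite a h p := by
  have hq := h1_sub_of_even a h (q := g) hg q
  have hp := h1_sub_of_even a h (q := g) hg p
  rw [add_comm q g, add_comm p g]
  rw [sub_eq_iff_eq_add'] at hq hp
  rw [hq, hp]
  abel

/-- Stencil bond vectors are unchanged by an even-layer translation of the base: `y_{m+g+s} − y_{m+g} = y_{m+s} − y_m`.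
[folklore] -/
theorem coreStarSite_stencil_translate (a h : ℝ) {g : ℤ × ℤ × ℤ} (hg : Even g.1) (m s : ℤ × ℤ × ℤ) :
    hcpSite a h (m + g + s) - hcpSite a h (m + g) = hcpSite a h (m + s) - hcpSite a h m := by
  rw [add_right_comm m g s]
  exact coreStarSite_sub_translate a h hg (m + s) m

/-- The sublattice parity is unchanged by an even-layer translation. [folklore] -/
theorem coreStarSite_parity_translate {g : ℤ × ℤ × ℤ} (hg : Even g.1) (k : ℤ) :
    Even (k + g.1) ↔ Even k :=
  Int.even_add.trans ⟨fun h => h.2 hg, fun h => ⟨fun _ => hg, fun _ => h⟩⟩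

/-- **Bravais covariance of the sitewise inequality**: for an even-layer index `g`, the inequality for the translated
field `q ↦ u (q + g)` at `p` is the inequality for `u` at `p + g` (same skew `W`; every series is re-indexed by
`q ↦ q + g`). [folklore] -/
theorem coreStarSiteIneq_translate {a h κ₁ κ₃ : ℝ} {Y : Finset (ℤ × ℤ × ℤ)}
    {M N : Bool → (ℤ × ℤ × ℤ) → (ℤ × ℤ × ℤ) → (ℤ × ℤ × ℤ) → ℝ}
    {u : ℤ × ℤ × ℤ → EuclideanSpace ℝ (Fin 3)} {p g : ℤ × ℤ × ℤ} (hg : Even g.1) :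
    CoreStarSiteIneq a h κ₁ κ₃ Y M N (fun q => u (q + g)) p ↔ CoreStarSiteIneq a h κ₁ κ₃ Y M N u (p + g) := by
  unfold CoreStarSiteIneq
  conv_rhs => enter [1, W, 2, 1, 1, 2]; rw [← (Equiv.addRight g).tsum_eq]
  conv_rhs => enter [1, W, 2, 1, 2, 2]; rw [← (Equiv.addRight g).tsum_eq]
  conv_rhs => enter [1, W, 2, 2, 1]; rw [← (Equiv.addRight g).tsum_eq]
  conv_rhs => enter [1, W, 2, 2, 2]; rw [← (Equiv.addRight g).tsum_eq]
  simp only [Equiv.coe_addRight, coreStarSite_sub_translate a h hg, Prod.fst_add,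
    coreStarSite_parity_translate hg, add_sub_add_right_eq_sub, add_left_inj, add_right_comm _ g]

/-- Finite support is preserved by translating the argument. [folklore] -/
theorem coreStarSite_support_translate {u : ℤ × ℤ × ℤ → EuclideanSpace ℝ (Fin 3)}
    (hu : (Function.support u).Finite) (g : ℤ × ℤ × ℤ) :
    (Function.support fun q => u (q + g)).Finite := by
  have : (Function.support fun q => u (q + g)) = (· + g) ⁻¹' Function.support u := by
    ext q; simp [Function.mem_support]
  rw [this]
  exact hu.preimage (add_left_injective g).injOn

/-- **Two sites suffice**: a covariant decaying table for which the sitewise inequality holds at the two sublattice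
representatives `(0,0,0)` (even layer) and `(1,0,0)` (odd layer), for every finitely supported `u`, proves H2⋆ —
every other site is an even-layer translate of one of them (`coreStarSiteIneq_translate`).  This is the reduction a
finite certificate of `CoreStarCoercive a h κ₁ κ₃` uses. [folklore] -/
theorem coreStarCoercive_of_two_sites {a h κ₁ κ₃ : ℝ}
    (hcert : ∃ (C : ℝ) (Y : Finset (ℤ × ℤ × ℤ)) (M N : Bool → (ℤ × ℤ × ℤ) → (ℤ × ℤ × ℤ) → (ℤ × ℤ × ℤ) → ℝ),
        (∀ b d s s', s ∉ Y ∨ s' ∉ Y → M b d s s' = 0 ∧ N b d s s' = 0) ∧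
        (∀ p q : ℤ × ℤ × ℤ, ∀ s s', |M (decide (Even p.1)) (q - p) s s'| ≤
            C * ((1 + ‖hcpSite a h q - hcpSite a h p‖)⁻¹) ^ 6 ∧
          |N (decide (Even p.1)) (q - p) s s'| ≤ C * ((1 + ‖hcpSite a h q - hcpSite a h p‖)⁻¹) ^ 6) ∧
        ∀ u : ℤ × ℤ × ℤ → EuclideanSpace ℝ (Fin 3), (Function.support u).Finite →
          CoreStarSiteIneq a h κ₁ κ₃ Y M N u (0, 0, 0) ∧ CoreStarSiteIneq a h κ₁ κ₃ Y M N u (1, 0, 0)) :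
    CoreStarCoercive a h κ₁ κ₃ := by
  rw [coreStarCoercive_iff_site]
  obtain ⟨C, Y, M, N, hY, hdec, h⟩ := hcert
  refine ⟨C, Y, M, N, hY, hdec, fun u hu p => ?_⟩
  rcases Int.even_or_odd p.1 with hp | hp
  · -- even layer: `p = (0,0,0) + p`
    have h0 := (h (fun q => u (q + p)) (coreStarSite_support_translate hu p)).1
    have := (coreStarSiteIneq_translate (p := (0, 0, 0)) (g := p) hp).1 h0
    have e : ((0, 0, 0) : ℤ × ℤ × ℤ) + p = p := by ext <;> simp
    rwa [e] at this
  · -- odd layer: `p = (1,0,0) + (p - (1,0,0))`, and `p - (1,0,0)` has even layer index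
    have hg : Even (p - (1, 0, 0)).1 := by
      show Even (p.1 - 1)
      obtain ⟨k, hk⟩ := hp
      exact ⟨k, by omega⟩
    have h1 := (h (fun q => u (q + (p - (1, 0, 0)))) (coreStarSite_support_translate hu _)).2
    have := (coreStarSiteIneq_translate (p := (1, 0, 0)) (g := p - (1, 0, 0)) hg).1 h1
    rwa [add_sub_cancel] at this

/-- **Registered anchor `stub_coreStarTwoSites`** (reshape r5): H2⋆ from a two-site certificate
(`coreStarCoercive_of_two_sites`, closed form). -/
theorem stub_coreStarTwoSites : ∀ a h κ₁ κ₃ : ℝ,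
    (∃ (C : ℝ) (Y : Finset (ℤ × ℤ × ℤ)) (M N : Bool → (ℤ × ℤ × ℤ) → (ℤ × ℤ × ℤ) → (ℤ × ℤ × ℤ) → ℝ),
        (∀ b d s s', s ∉ Y ∨ s' ∉ Y → M b d s s' = 0 ∧ N b d s s' = 0) ∧
        (∀ p q : ℤ × ℤ × ℤ, ∀ s s', |M (decide (Even p.1)) (q - p) s s'| ≤
            C * ((1 + ‖hcpSite a h q - hcpSite a h p‖)⁻¹) ^ 6 ∧
          |N (decide (Even p.1)) (q - p) s s'| ≤ C * ((1 + ‖hcpSite a h q - hcpSite a h p‖)⁻¹) ^ 6) ∧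
        ∀ u : ℤ × ℤ × ℤ → EuclideanSpace ℝ (Fin 3), (Function.support u).Finite →
          CoreStarSiteIneq a h κ₁ κ₃ Y M N u (0, 0, 0) ∧ CoreStarSiteIneq a h κ₁ κ₃ Y M N u (1, 0, 0)) →
    CoreStarCoercive a h κ₁ κ₃ :=
  fun _ _ _ _ hcert => coreStarCoercive_of_two_sites hcert

end Summit.AtomisticToContinuum.Crystallization.Theorems.StrictSplittingRuleBirth

end
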